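import Literature.Probability.LatticeModels.MeshDomainJordan
import Literature.Probability.LatticeModels.CellGridSaddleSymmetry
import HarnessLib

/-!
# Big mesh components of a Jordan domain are the bulk (`δℤ²`)

Topic: Probability / LatticeModels (a corollary of the series ending with `MeshDomainJordan.lean`).
H21 discretises a planar domain `Ω` at mesh `δ` by `meshDomain Ω δ`, the union of the connected
components of maximal cardinality of the mesh graph on `Ω ∩ δℤ²` ("the largest connected
component", Smirnov 2001, §2). When an open lattice path built inside `Ω` (e.g. a crossing of a
longer, thinner comparison domain, Bollobás–Riordan 2006, Ch. 7, Claim 19) has to be recognised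
as a path *of `Ω_δ`*, one needs to know that it does not run in a stray component. This file
proves the macroscopic-diameter criterion:

**Theorem** (`JordanDomain.exists_mem_meshDomain_of_reachable`). For a Jordan domain `D` and
`d₀ > 0`, for all small `δ > 0`: if two mesh vertices are joined in the mesh graph on mesh
vertices and their mesh points are at Euclidean distance `≥ d₀`, they lie in
`meshDomain D.carrier δ`.

Proof. Suppose the component of `x` is not the bulk. It avoids the compact
`K_ε = {z | ε ≤ dist(z, Ωᶜ)} ⊆ Ω`, which is swallowed by `meshDomain` for small `δ`
(`JordanDomain.exists_forall_mem_meshDomain_and_reachable`), so it is *stray* and by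
`JordanDomain.mul_sub_lt_of_stray` its horizontal extent is `< d₀ / 2`. The quarter turn
`z ↦ i z` is a symmetry of `δℤ²` transporting mesh vertices, the mesh graph and `meshDomain`
(`CellSymmetry.rot`, `CellGridSaddleSymmetry.lean`), so the same theorem for the Jordan domain
`i·D` bounds the vertical extent by `d₀ / 2`; hence `dist (δx) (δy) < d₀`.

This is the `ℤ²` twin of `JordanDomain.exists_mem_triMeshDomain_of_reachable`
(`Percolation/TriCrossingSandwich.lean`, where the second direction is obtained from complex
conjugation, a symmetry of `𝕋`). Folklore (no source treats lattice-point counts of mesh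
components of Jordan domains). Not here: any statement about the size of `meshDomain` itself
(see `MeshDomainJordan.lean`), or about domains that are not Jordan.

Mathlib anchors: `Metric.infDist`, `SimpleGraph.Reachable`, `SimpleGraph.ConnectedComponent.supp`,
`LinearIsometryEquiv.toHomeomorph`. H21 anchors: `JordanDomain.exists_forall_mem_meshDomain_and_reachable`
(`MeshDomainJordan.lean`), `JordanDomain.mul_sub_lt_of_stray` (`MeshStrayExtent.lean`),
`JordanDomain.map` (`ChordalCurveFamily.lean`), `CellSymmetry.rot`, `CellSymmetry.mem_meshDomain_cell`,
`CellSymmetry.reachable_cell_iff` (`CellGridSaddleSymmetry.lean`).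
-/

namespace Literature.Probability.LatticeModels

open Set Metric Literature.Probability.RandomPlanarGeometry

noncomputable section

/-! ### Preliminaries -/

/-- `Ω_δ` is a union of whole mesh components: a mesh vertex joined in the mesh graph on mesh
vertices to a vertex of `Ω_δ = meshDomain Ω δ` belongs to `Ω_δ`. [folklore] -/
theorem mem_meshDomain_of_reachable_meshVertexGraph {Ω : Set ℂ} {δ : ℝ} {x y : Site 2}
    (hx : x ∈ meshDomain Ω δ) (hxv : x ∈ meshVertices Ω δ) (hyv : y ∈ meshVertices Ω δ)
    (h : (meshVertexGraph Ω δ).Reachable ⟨x, hxv⟩ ⟨y, hyv⟩) : y ∈ meshDomain Ω δ := by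
  simp only [meshDomain, mem_iUnion, mem_image] at hx ⊢
  obtain ⟨C, hC, x', hx'C, hx'x⟩ := hx
  have hxx' : x' = ⟨x, hxv⟩ := Subtype.ext hx'x
  subst hxx'
  refine ⟨C, hC, ⟨y, hyv⟩, ?_, rfl⟩
  rw [SimpleGraph.ConnectedComponent.mem_supp_iff] at hx'C ⊢
  rw [← hx'C]
  exact SimpleGraph.ConnectedComponent.sound h.symm

/-- **Two small coordinate extents give a small Euclidean distance** on `δℤ²`:
`|δ(x₀ - y₀)| < d/2` and `|δ(x₁ - y₁)| < d/2` give `dist (δx) (δy) < d`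
(`‖w‖ ≤ |Re w| + |Im w|`). [folklore] -/
theorem dist_meshPoint_lt_of_abs_sub_lt {δ d : ℝ} {x y : Site 2}
    (h0 : |δ * (((x 0 : ℤ) : ℝ) - ((y 0 : ℤ) : ℝ))| < d / 2)
    (h1 : |δ * (((x 1 : ℤ) : ℝ) - ((y 1 : ℤ) : ℝ))| < d / 2) :
    dist (meshPoint δ x) (meshPoint δ y) < d := by
  rw [Complex.dist_eq]
  refine (Complex.norm_le_abs_re_add_abs_im _).trans_lt ?_
  have hre : (meshPoint δ x - meshPoint δ y).re = δ * (((x 0 : ℤ) : ℝ) - ((y 0 : ℤ) : ℝ)) := by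
    simp only [Complex.sub_re, meshPoint_re]; ring
  have him : (meshPoint δ x - meshPoint δ y).im = δ * (((x 1 : ℤ) : ℝ) - ((y 1 : ℤ) : ℝ)) := by
    simp only [Complex.sub_im, meshPoint_im]; ring
  rw [hre, him]
  linarith

/-- The set `K_ε = {z | ε ≤ dist(z, Ωᶜ)}` of `ε`-deep points of a Jordan domain (`ε > 0`) is a
compact subset of the domain (closed, and bounded as a subset of the bounded carrier).
[folklore] -/
theorem _root_.Literature.Probability.RandomPlanarGeometry.JordanDomain.isCompact_setOf_le_infDist_compl
    (D : JordanDomain) {ε : ℝ} (hε : 0 < ε) :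
    IsCompact {z : ℂ | ε ≤ infDist z D.carrierᶜ} ∧
      {z : ℂ | ε ≤ infDist z D.carrierᶜ} ⊆ D.carrier := by
  have hsub : {z : ℂ | ε ≤ infDist z D.carrierᶜ} ⊆ D.carrier := fun z hz => by
    by_contra h
    have h0 : infDist z D.carrierᶜ = 0 := infDist_zero_of_mem h
    have hz' : ε ≤ infDist z D.carrierᶜ := hz
    linarith
  exact ⟨Metric.isCompact_of_isClosed_isBounded
    (isClosed_le continuous_const (continuous_infDist_pt _)) (D.isBounded.subset hsub), hsub⟩

/-! ### The theorem -/

/-- **Big mesh components are the bulk (`δℤ²`).** For a Jordan domain `D` and `d₀ > 0`, for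
all small meshes `δ`: if two mesh vertices are joined in the mesh graph of `D` on mesh vertices
and their mesh points are at Euclidean distance `≥ d₀`, then they lie in the discrete domain
`Ω_δ = meshDomain D.carrier δ` (the union of the largest components). See the module docstring
for the proof (stray components have horizontal extent `< d₀ / 2` for `D`, and for the
quarter-turned domain `i·D`, which bounds the vertical extent). [folklore] -/
theorem _root_.Literature.Probability.RandomPlanarGeometry.JordanDomain.exists_mem_meshDomain_of_reachable
    (D : JordanDomain) {d₀ : ℝ} (hd₀ : 0 < d₀) :
    ∃ δ₀ > 0, ∀ δ : ℝ, 0 < δ → δ < δ₀ →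
      ∀ x y : meshVertices D.carrier δ, (meshVertexGraph D.carrier δ).Reachable x y →
        d₀ ≤ dist (meshPoint δ (x : Site 2)) (meshPoint δ (y : Site 2)) →
        (x : Site 2) ∈ meshDomain D.carrier δ := by
  have hD₀ : 0 < d₀ / 2 := by positivity
  -- the quarter-turned domain
  set D' : JordanDomain := D.map CellSymmetry.rot.plane.toHomeomorph with hD'
  have hD'c : D'.carrier = CellSymmetry.rot.plane '' D.carrier := by
    rw [hD', JordanDomain.carrier_map, LinearIsometryEquiv.coe_toHomeomorph]
  -- stray extents for `D` and `D'`
  obtain ⟨ε, hε, δ₁, hδ₁, hstray⟩ := D.mul_sub_lt_of_stray hD₀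
  obtain ⟨ε', hε', δ₁', hδ₁', hstray'⟩ := D'.mul_sub_lt_of_stray hD₀
  -- the swallowed compacts
  obtain ⟨hKc, hKΩ⟩ := D.isCompact_setOf_le_infDist_compl hε
  obtain ⟨hKc', hKΩ'⟩ := D'.isCompact_setOf_le_infDist_compl hε'
  obtain ⟨δ₂, hδ₂, hbulk⟩ := D.exists_forall_mem_meshDomain_and_reachable hKc hKΩ
  obtain ⟨δ₂', hδ₂', hbulk'⟩ := D'.exists_forall_mem_meshDomain_and_reachable hKc' hKΩ'
  rw [hD'c] at hstray' hbulk'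
  refine ⟨min (min δ₁ δ₁') (min δ₂ δ₂'), by positivity, fun δ hδ hδlt x y hxy hdist => ?_⟩
  have hδδ₁ : δ < δ₁ := hδlt.trans_le ((min_le_left _ _).trans (min_le_left _ _))
  have hδδ₁' : δ < δ₁' := hδlt.trans_le ((min_le_left _ _).trans (min_le_right _ _))
  have hδδ₂ : δ < δ₂ := hδlt.trans_le ((min_le_right _ _).trans (min_le_left _ _))
  have hδδ₂' : δ < δ₂' := hδlt.trans_le ((min_le_right _ _).trans (min_le_right _ _))
  by_contra hxD
  -- every vertex joined to `x` is off `Ω_δ`, hence shallow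
  have hoff : ∀ z : meshVertices D.carrier δ, (meshVertexGraph D.carrier δ).Reachable x z →
      (z : Site 2) ∉ meshDomain D.carrier δ := fun z hz hzD =>
    hxD (mem_meshDomain_of_reachable_meshVertexGraph hzD z.2 x.2 hz.symm)
  have hshallow : ∀ z : meshVertices D.carrier δ, (meshVertexGraph D.carrier δ).Reachable x z →
      infDist (meshPoint δ (z : Site 2)) D.carrierᶜ < ε := by
    intro z hz
    by_contra hge
    push Not at hge
    exact hoff z hz ((hbulk δ hδ hδδ₂).1 z hge)
  -- horizontal extent, both ways
  have h0 : δ * (((y : Site 2) 0 : ℝ) - ((x : Site 2) 0 : ℝ)) < d₀ / 2 :=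
    hstray δ hδ hδδ₁ x y hxy hshallow
  have h0' : δ * (((x : Site 2) 0 : ℝ) - ((y : Site 2) 0 : ℝ)) < d₀ / 2 :=
    hstray δ hδ hδδ₁ y x hxy.symm (fun z hz => hshallow z (hxy.trans hz))
  -- the quarter turn: vertical extent
  have hmem : ∀ z : meshVertices D.carrier δ,
      CellSymmetry.rot.cell (z : Site 2) ∈ meshVertices (CellSymmetry.rot.plane '' D.carrier) δ :=
    fun z => CellSymmetry.rot.mem_meshVertices_cell.2 z.2
  set x' : meshVertices (CellSymmetry.rot.plane '' D.carrier) δ :=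
    ⟨CellSymmetry.rot.cell (x : Site 2), hmem x⟩ with hx'
  set y' : meshVertices (CellSymmetry.rot.plane '' D.carrier) δ :=
    ⟨CellSymmetry.rot.cell (y : Site 2), hmem y⟩ with hy'
  have hxy' : (meshVertexGraph (CellSymmetry.rot.plane '' D.carrier) δ).Reachable x' y' :=
    (CellSymmetry.rot.reachable_cell_iff x.2 y.2).2 hxy
  have hshallow' : ∀ z : meshVertices (CellSymmetry.rot.plane '' D.carrier) δ,
      (meshVertexGraph (CellSymmetry.rot.plane '' D.carrier) δ).Reachable x' z →
      infDist (meshPoint δ (z : Site 2)) (CellSymmetry.rot.plane '' D.carrier)ᶜ < ε' := by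
    intro z hz
    by_contra hge
    push Not at hge
    have hzD' : (z : Site 2) ∈ meshDomain (CellSymmetry.rot.plane '' D.carrier) δ :=
      (hbulk' δ hδ hδδ₂').1 z hge
    have hw : CellSymmetry.rot.cell.symm (z : Site 2) ∈ meshVertices D.carrier δ :=
      CellSymmetry.rot.mem_meshVertices_cell_symm.2 z.2
    have hwD : CellSymmetry.rot.cell.symm (z : Site 2) ∈ meshDomain D.carrier δ :=
      CellSymmetry.rot.mem_meshDomain_cell.1 (by rw [Equiv.apply_symm_apply]; exact hzD')
    have hreach : (meshVertexGraph D.carrier δ).Reachable x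
        ⟨CellSymmetry.rot.cell.symm (z : Site 2), hw⟩ := by
      refine (CellSymmetry.rot.reachable_cell_iff x.2 hw).1 ?_
      have hz' : (⟨CellSymmetry.rot.cell (CellSymmetry.rot.cell.symm (z : Site 2)),
          CellSymmetry.rot.mem_meshVertices_cell.2 hw⟩ :
          meshVertices (CellSymmetry.rot.plane '' D.carrier) δ) = z :=
        Subtype.ext (CellSymmetry.rot.cell.apply_symm_apply _)
      rw [hz']
      exact hz
    exact hoff _ hreach hwD
  have h1 : δ * (((y' : Site 2) 0 : ℝ) - ((x' : Site 2) 0 : ℝ)) < d₀ / 2 :=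
    hstray' δ hδ hδδ₁' x' y' hxy' hshallow'
  have h1' : δ * (((x' : Site 2) 0 : ℝ) - ((y' : Site 2) 0 : ℝ)) < d₀ / 2 :=
    hstray' δ hδ hδδ₁' y' x' hxy'.symm (fun z hz => hshallow' z (hxy'.trans hz))
  have hx'0 : (((x' : Site 2) 0 : ℤ) : ℝ) = -(((x : Site 2) 1 : ℤ) : ℝ) := by
    have : ((x' : Site 2) 0 : ℤ) = -((x : Site 2) 1) := rfl
    rw [this]; push_cast; ring
  have hy'0 : (((y' : Site 2) 0 : ℤ) : ℝ) = -(((y : Site 2) 1 : ℤ) : ℝ) := by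
    have : ((y' : Site 2) 0 : ℤ) = -((y : Site 2) 1) := rfl
    rw [this]; push_cast; ring
  rw [hx'0, hy'0] at h1 h1'
  -- the distance bound
  have hA : |δ * (((x : Site 2) 0 : ℝ) - ((y : Site 2) 0 : ℝ))| < d₀ / 2 := by
    rw [abs_lt]; constructor <;> nlinarith
  have hB : |δ * (((x : Site 2) 1 : ℝ) - ((y : Site 2) 1 : ℝ))| < d₀ / 2 := by
    rw [abs_lt]; constructor <;> nlinarith
  have hd := dist_meshPoint_lt_of_abs_sub_lt hA hB
  linarith

/-- Symmetric form: under the hypotheses of `JordanDomain.exists_mem_meshDomain_of_reachable`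
both end-points lie in `Ω_δ`. [folklore] -/
theorem _root_.Literature.Probability.RandomPlanarGeometry.JordanDomain.exists_mem_meshDomain_and_mem_of_reachable
    (D : JordanDomain) {d₀ : ℝ} (hd₀ : 0 < d₀) :
    ∃ δ₀ > 0, ∀ δ : ℝ, 0 < δ → δ < δ₀ →
      ∀ x y : meshVertices D.carrier δ, (meshVertexGraph D.carrier δ).Reachable x y →
        d₀ ≤ dist (meshPoint δ (x : Site 2)) (meshPoint δ (y : Site 2)) →
        (x : Site 2) ∈ meshDomain D.carrier δ ∧ (y : Site 2) ∈ meshDomain D.carrier δ := by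
  obtain ⟨δ₀, hδ₀, h⟩ := D.exists_mem_meshDomain_of_reachable hd₀
  refine ⟨δ₀, hδ₀, fun δ hδ hδlt x y hxy hdist => ?_⟩
  have hx := h δ hδ hδlt x y hxy hdist
  exact ⟨hx, mem_meshDomain_of_reachable_meshVertexGraph hx x.2 y.2 hxy⟩

end

end Literature.Probability.LatticeModels
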